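import Literature.NumberTheory.EllipticCurves.PointCountEulerCriterion
import HarnessLib

/-!
# BSD rank-≤1 residual cell, class X11 ∧ r = 1 ∧ ¬sst ∧ p ≥ 5: kernel point counts `#Ẽ(𝔽_ℓ)` at
# the SERRE WITNESS primes of the 11 (ram)-free records (kernel-decided data)

HONEST FRAMING (cell `b2b-bsdres-*`, verbatim): prove what is provable now; shrink each hard class
to its core with data; no claim beyond stated classes; COMBINATION classes deleted from PUBLISHED
theorems only, CONSTRUCTION-shaped remainder typed; this is not "finishing BSD".

Theorems only (kernel-decided data, Kenku-file pattern `card_<E>_<ℓ>`: `natCard_point_eq_one_add_card`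
+ `card_sol_eq_sum_euler` + `decide +kernel`; no definition, no named fact, no `native_decide`).
For the 11 records of `X11RankOneCertificates.records{1,2}` without a (ram) witness
(`X11RankOne.ram_nil_exactly`: 8085y1, 8670u1, 10890cc1, 12705q1, 13230dt1, 14560d1, 15390r1,
16905bb1, 17955m1, 18360a1, 19170s1) the point counts `#Ẽ(𝔽_ℓ) = n` at their three Serre witness
primes `ℓ` (record field `serre = [(ℓ₁,a₁),(ℓ₂,a₂),(ℓ₃,a₃)]`, `aᵢ = ℓᵢ + 1 − nᵢ`), except the
counts already landed in `Rank1ResidualX11RankOneFrobeniusCards{1,2}`. Consumer: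
`Rank1ResidualX11RankOneSurj.lean` (`ρ̄_{E,p}` onto by Serre 1972 Prop. 19, in the kernel).

References: J.-P. Serre, Invent. Math. 15 (1972) §2.8 Prop. 19 [Serre1972]; K. Ireland, M. Rosen,
GTM 84 (1990) Prop. 5.1.2 [IrelandRosen1990]; Cremona's tables [Cremona2006].
-/

set_option linter.dupNamespace false

namespace Summit.BirchSwinnertonDyer.BirchSwinnertonDyer.Rank1Residual.X11RankOne

open Literature.NumberTheory.EllipticCurves

/-- `#Ẽ(𝔽_17) = 21` (`a_17 = -3`, a Serre witness mod `p = 5`) for record `8085y1`. [folklore] -/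
theorem card_c8085y1_17 :
    Nat.card (((⟨0, 1, 1, -6435, -644416⟩ : WeierstrassCurve ℤ).map (Int.castRingHom (ZMod 17))).toAffine.Point) = 21 := by
  rw [@WeierstrassCurve.natCard_point_eq_one_add_card (ZMod 17) (@ZMod.instField 17 ⟨by norm_num⟩) _ _ _
    (by decide +kernel), @card_sol_eq_sum_euler (ZMod 17) (@ZMod.instField 17 ⟨by norm_num⟩) _ _
    (by rw [ZMod.ringChar_zmod_n]; decide), ZMod.card]
  decide +kernel

/-- `#Ẽ(𝔽_19) = 17` (`a_19 = 3`, a Serre witness mod `p = 5`) for record `8085y1`. [folklore] -/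
theorem card_c8085y1_19 :
    Nat.card (((⟨0, 1, 1, -6435, -644416⟩ : WeierstrassCurve ℤ).map (Int.castRingHom (ZMod 19))).toAffine.Point) = 17 := by
  rw [@WeierstrassCurve.natCard_point_eq_one_add_card (ZMod 19) (@ZMod.instField 19 ⟨by norm_num⟩) _ _ _
    (by decide +kernel), @card_sol_eq_sum_euler (ZMod 19) (@ZMod.instField 19 ⟨by norm_num⟩) _ _
    (by rw [ZMod.ringChar_zmod_n]; decide), ZMod.card]
  decide +kernel

/-- `#Ẽ(𝔽_47) = 42` (`a_47 = 6`, a Serre witness mod `p = 5`) for record `8085y1`. [folklore] -/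
theorem card_c8085y1_47 :
    Nat.card (((⟨0, 1, 1, -6435, -644416⟩ : WeierstrassCurve ℤ).map (Int.castRingHom (ZMod 47))).toAffine.Point) = 42 := by
  rw [@WeierstrassCurve.natCard_point_eq_one_add_card (ZMod 47) (@ZMod.instField 47 ⟨by norm_num⟩) _ _ _
    (by decide +kernel), @card_sol_eq_sum_euler (ZMod 47) (@ZMod.instField 47 ⟨by norm_num⟩) _ _
    (by rw [ZMod.ringChar_zmod_n]; decide), ZMod.card]
  decide +kernel

/-- `#Ẽ(𝔽_43) = 50` (`a_43 = -6`, a Serre witness mod `p = 5`) for record `8670u1`. [folklore] -/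
theorem card_c8670u1_43 :
    Nat.card (((⟨1, 0, 0, 249, 3465⟩ : WeierstrassCurve ℤ).map (Int.castRingHom (ZMod 43))).toAffine.Point) = 50 := by
  rw [@WeierstrassCurve.natCard_point_eq_one_add_card (ZMod 43) (@ZMod.instField 43 ⟨by norm_num⟩) _ _ _
    (by decide +kernel), @card_sol_eq_sum_euler (ZMod 43) (@ZMod.instField 43 ⟨by norm_num⟩) _ _
    (by rw [ZMod.ringChar_zmod_n]; decide), ZMod.card]
  decide +kernel

/-- `#Ẽ(𝔽_11) = 16` (`a_11 = -4`, a Serre witness mod `p = 5`) for record `8670u1`. [folklore] -/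
theorem card_c8670u1_11 :
    Nat.card (((⟨1, 0, 0, 249, 3465⟩ : WeierstrassCurve ℤ).map (Int.castRingHom (ZMod 11))).toAffine.Point) = 16 := by
  rw [@WeierstrassCurve.natCard_point_eq_one_add_card (ZMod 11) (@ZMod.instField 11 ⟨by norm_num⟩) _ _ _
    (by decide +kernel), @card_sol_eq_sum_euler (ZMod 11) (@ZMod.instField 11 ⟨by norm_num⟩) _ _
    (by rw [ZMod.ringChar_zmod_n]; decide), ZMod.card]
  decide +kernel

/-- `#Ẽ(𝔽_23) = 22` (`a_23 = 2`, a Serre witness mod `p = 5`) for record `8670u1`. [folklore] -/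
theorem card_c8670u1_23 :
    Nat.card (((⟨1, 0, 0, 249, 3465⟩ : WeierstrassCurve ℤ).map (Int.castRingHom (ZMod 23))).toAffine.Point) = 22 := by
  rw [@WeierstrassCurve.natCard_point_eq_one_add_card (ZMod 23) (@ZMod.instField 23 ⟨by norm_num⟩) _ _ _
    (by decide +kernel), @card_sol_eq_sum_euler (ZMod 23) (@ZMod.instField 23 ⟨by norm_num⟩) _ _
    (by rw [ZMod.ringChar_zmod_n]; decide), ZMod.card]
  decide +kernel

/-- `#Ẽ(𝔽_37) = 45` (`a_37 = -7`, a Serre witness mod `p = 5`) for record `10890cc1`. [folklore] -/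
theorem card_c10890cc1_37 :
    Nat.card (((⟨1, -1, 1, -7052, 229551⟩ : WeierstrassCurve ℤ).map (Int.castRingHom (ZMod 37))).toAffine.Point) = 45 := by
  rw [@WeierstrassCurve.natCard_point_eq_one_add_card (ZMod 37) (@ZMod.instField 37 ⟨by norm_num⟩) _ _ _
    (by decide +kernel), @card_sol_eq_sum_euler (ZMod 37) (@ZMod.instField 37 ⟨by norm_num⟩) _ _
    (by rw [ZMod.ringChar_zmod_n]; decide), ZMod.card]
  decide +kernel

/-- `#Ẽ(𝔽_19) = 21` (`a_19 = -1`, a Serre witness mod `p = 7`) for record `12705q1`. [folklore] -/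
theorem card_c12705q1_19 :
    Nat.card (((⟨0, 1, 1, 65905, -3375619⟩ : WeierstrassCurve ℤ).map (Int.castRingHom (ZMod 19))).toAffine.Point) = 21 := by
  rw [@WeierstrassCurve.natCard_point_eq_one_add_card (ZMod 19) (@ZMod.instField 19 ⟨by norm_num⟩) _ _ _
    (by decide +kernel), @card_sol_eq_sum_euler (ZMod 19) (@ZMod.instField 19 ⟨by norm_num⟩) _ _
    (by rw [ZMod.ringChar_zmod_n]; decide), ZMod.card]
  decide +kernel

/-- `#Ẽ(𝔽_17) = 26` (`a_17 = -8`, a Serre witness mod `p = 5`) for record `13230dt1`. [folklore] -/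
theorem card_c13230dt1_17 :
    Nat.card (((⟨1, -1, 1, -321572, 71118919⟩ : WeierstrassCurve ℤ).map (Int.castRingHom (ZMod 17))).toAffine.Point) = 26 := by
  rw [@WeierstrassCurve.natCard_point_eq_one_add_card (ZMod 17) (@ZMod.instField 17 ⟨by norm_num⟩) _ _ _
    (by decide +kernel), @card_sol_eq_sum_euler (ZMod 17) (@ZMod.instField 17 ⟨by norm_num⟩) _ _
    (by rw [ZMod.ringChar_zmod_n]; decide), ZMod.card]
  decide +kernel

/-- `#Ẽ(𝔽_13) = 17` (`a_13 = -3`, a Serre witness mod `p = 5`) for record `13230dt1`. [folklore] -/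
theorem card_c13230dt1_13 :
    Nat.card (((⟨1, -1, 1, -321572, 71118919⟩ : WeierstrassCurve ℤ).map (Int.castRingHom (ZMod 13))).toAffine.Point) = 17 := by
  rw [@WeierstrassCurve.natCard_point_eq_one_add_card (ZMod 13) (@ZMod.instField 13 ⟨by norm_num⟩) _ _ _
    (by decide +kernel), @card_sol_eq_sum_euler (ZMod 13) (@ZMod.instField 13 ⟨by norm_num⟩) _ _
    (by rw [ZMod.ringChar_zmod_n]; decide), ZMod.card]
  decide +kernel

/-- `#Ẽ(𝔽_17) = 26` (`a_17 = -8`, a Serre witness mod `p = 5`) for record `14560d1`. [folklore] -/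
theorem card_c14560d1_17 :
    Nat.card (((⟨0, 1, 0, -630026, 192068320⟩ : WeierstrassCurve ℤ).map (Int.castRingHom (ZMod 17))).toAffine.Point) = 26 := by
  rw [@WeierstrassCurve.natCard_point_eq_one_add_card (ZMod 17) (@ZMod.instField 17 ⟨by norm_num⟩) _ _ _
    (by decide +kernel), @card_sol_eq_sum_euler (ZMod 17) (@ZMod.instField 17 ⟨by norm_num⟩) _ _
    (by rw [ZMod.ringChar_zmod_n]; decide), ZMod.card]
  decide +kernel

/-- `#Ẽ(𝔽_13) = 20` (`a_13 = -6`, a Serre witness mod `p = 5`) for record `15390r1`. [folklore] -/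
theorem card_c15390r1_13 :
    Nat.card (((⟨1, -1, 1, -4213103, -3327467913⟩ : WeierstrassCurve ℤ).map (Int.castRingHom (ZMod 13))).toAffine.Point) = 20 := by
  rw [@WeierstrassCurve.natCard_point_eq_one_add_card (ZMod 13) (@ZMod.instField 13 ⟨by norm_num⟩) _ _ _
    (by decide +kernel), @card_sol_eq_sum_euler (ZMod 13) (@ZMod.instField 13 ⟨by norm_num⟩) _ _
    (by rw [ZMod.ringChar_zmod_n]; decide), ZMod.card]
  decide +kernel

/-- `#Ẽ(𝔽_17) = 19` (`a_17 = -1`, a Serre witness mod `p = 5`) for record `15390r1`. [folklore] -/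
theorem card_c15390r1_17 :
    Nat.card (((⟨1, -1, 1, -4213103, -3327467913⟩ : WeierstrassCurve ℤ).map (Int.castRingHom (ZMod 17))).toAffine.Point) = 19 := by
  rw [@WeierstrassCurve.natCard_point_eq_one_add_card (ZMod 17) (@ZMod.instField 17 ⟨by norm_num⟩) _ _ _
    (by decide +kernel), @card_sol_eq_sum_euler (ZMod 17) (@ZMod.instField 17 ⟨by norm_num⟩) _ _
    (by rw [ZMod.ringChar_zmod_n]; decide), ZMod.card]
  decide +kernel

/-- `#Ẽ(𝔽_17) = 16` (`a_17 = 2`, a Serre witness mod `p = 5`) for record `16905bb1`. [folklore] -/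
theorem card_c16905bb1_17 :
    Nat.card (((⟨0, 1, 1, -4833915, -5051688631⟩ : WeierstrassCurve ℤ).map (Int.castRingHom (ZMod 17))).toAffine.Point) = 16 := by
  rw [@WeierstrassCurve.natCard_point_eq_one_add_card (ZMod 17) (@ZMod.instField 17 ⟨by norm_num⟩) _ _ _
    (by decide +kernel), @card_sol_eq_sum_euler (ZMod 17) (@ZMod.instField 17 ⟨by norm_num⟩) _ _
    (by rw [ZMod.ringChar_zmod_n]; decide), ZMod.card]
  decide +kernel

/-- `#Ẽ(𝔽_19) = 27` (`a_19 = -7`, a Serre witness mod `p = 5`) for record `16905bb1`. [folklore] -/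
theorem card_c16905bb1_19 :
    Nat.card (((⟨0, 1, 1, -4833915, -5051688631⟩ : WeierstrassCurve ℤ).map (Int.castRingHom (ZMod 19))).toAffine.Point) = 27 := by
  rw [@WeierstrassCurve.natCard_point_eq_one_add_card (ZMod 19) (@ZMod.instField 19 ⟨by norm_num⟩) _ _ _
    (by decide +kernel), @card_sol_eq_sum_euler (ZMod 19) (@ZMod.instField 19 ⟨by norm_num⟩) _ _
    (by rw [ZMod.ringChar_zmod_n]; decide), ZMod.card]
  decide +kernel

/-- `#Ẽ(𝔽_47) = 47` (`a_47 = 1`, a Serre witness mod `p = 5`) for record `16905bb1`. [folklore] -/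
theorem card_c16905bb1_47 :
    Nat.card (((⟨0, 1, 1, -4833915, -5051688631⟩ : WeierstrassCurve ℤ).map (Int.castRingHom (ZMod 47))).toAffine.Point) = 47 := by
  rw [@WeierstrassCurve.natCard_point_eq_one_add_card (ZMod 47) (@ZMod.instField 47 ⟨by norm_num⟩) _ _ _
    (by decide +kernel), @card_sol_eq_sum_euler (ZMod 47) (@ZMod.instField 47 ⟨by norm_num⟩) _ _
    (by rw [ZMod.ringChar_zmod_n]; decide), ZMod.card]
  decide +kernel

/-- `#Ẽ(𝔽_13) = 16` (`a_13 = -2`, a Serre witness mod `p = 7`) for record `17955m1`. [folklore] -/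
theorem card_c17955m1_13 :
    Nat.card (((⟨0, 0, 1, 177363, -146444578⟩ : WeierstrassCurve ℤ).map (Int.castRingHom (ZMod 13))).toAffine.Point) = 16 := by
  rw [@WeierstrassCurve.natCard_point_eq_one_add_card (ZMod 13) (@ZMod.instField 13 ⟨by norm_num⟩) _ _ _
    (by decide +kernel), @card_sol_eq_sum_euler (ZMod 13) (@ZMod.instField 13 ⟨by norm_num⟩) _ _
    (by rw [ZMod.ringChar_zmod_n]; decide), ZMod.card]
  decide +kernel

/-- `#Ẽ(𝔽_43) = 55` (`a_43 = -11`, a Serre witness mod `p = 5`) for record `18360a1`. [folklore] -/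
theorem card_c18360a1_43 :
    Nat.card (((⟨0, 0, 0, -567108, 291964932⟩ : WeierstrassCurve ℤ).map (Int.castRingHom (ZMod 43))).toAffine.Point) = 55 := by
  rw [@WeierstrassCurve.natCard_point_eq_one_add_card (ZMod 43) (@ZMod.instField 43 ⟨by norm_num⟩) _ _ _
    (by decide +kernel), @card_sol_eq_sum_euler (ZMod 43) (@ZMod.instField 43 ⟨by norm_num⟩) _ _
    (by rw [ZMod.ringChar_zmod_n]; decide), ZMod.card]
  decide +kernel

/-- `#Ẽ(𝔽_23) = 27` (`a_23 = -3`, a Serre witness mod `p = 5`) for record `18360a1`. [folklore] -/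
theorem card_c18360a1_23 :
    Nat.card (((⟨0, 0, 0, -567108, 291964932⟩ : WeierstrassCurve ℤ).map (Int.castRingHom (ZMod 23))).toAffine.Point) = 27 := by
  rw [@WeierstrassCurve.natCard_point_eq_one_add_card (ZMod 23) (@ZMod.instField 23 ⟨by norm_num⟩) _ _ _
    (by decide +kernel), @card_sol_eq_sum_euler (ZMod 23) (@ZMod.instField 23 ⟨by norm_num⟩) _ _
    (by rw [ZMod.ringChar_zmod_n]; decide), ZMod.card]
  decide +kernel

/-- `#Ẽ(𝔽_7) = 6` (`a_7 = 2`, a Serre witness mod `p = 5`) for record `19170s1`. [folklore] -/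
theorem card_c19170s1_7 :
    Nat.card (((⟨1, -1, 1, -105383, 13215711⟩ : WeierstrassCurve ℤ).map (Int.castRingHom (ZMod 7))).toAffine.Point) = 6 := by
  rw [@WeierstrassCurve.natCard_point_eq_one_add_card (ZMod 7) (@ZMod.instField 7 ⟨by norm_num⟩) _ _ _
    (by decide +kernel), @card_sol_eq_sum_euler (ZMod 7) (@ZMod.instField 7 ⟨by norm_num⟩) _ _
    (by rw [ZMod.ringChar_zmod_n]; decide), ZMod.card]
  decide +kernel

/-- `#Ẽ(𝔽_29) = 38` (`a_29 = -8`, a Serre witness mod `p = 5`) for record `19170s1`. [folklore] -/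
theorem card_c19170s1_29 :
    Nat.card (((⟨1, -1, 1, -105383, 13215711⟩ : WeierstrassCurve ℤ).map (Int.castRingHom (ZMod 29))).toAffine.Point) = 38 := by
  rw [@WeierstrassCurve.natCard_point_eq_one_add_card (ZMod 29) (@ZMod.instField 29 ⟨by norm_num⟩) _ _ _
    (by decide +kernel), @card_sol_eq_sum_euler (ZMod 29) (@ZMod.instField 29 ⟨by norm_num⟩) _ _
    (by rw [ZMod.ringChar_zmod_n]; decide), ZMod.card]
  decide +kernel

/-- `#Ẽ(𝔽_47) = 59` (`a_47 = -11`, a Serre witness mod `p = 5`) for record `19170s1`. [folklore] -/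
theorem card_c19170s1_47 :
    Nat.card (((⟨1, -1, 1, -105383, 13215711⟩ : WeierstrassCurve ℤ).map (Int.castRingHom (ZMod 47))).toAffine.Point) = 59 := by
  rw [@WeierstrassCurve.natCard_point_eq_one_add_card (ZMod 47) (@ZMod.instField 47 ⟨by norm_num⟩) _ _ _
    (by decide +kernel), @card_sol_eq_sum_euler (ZMod 47) (@ZMod.instField 47 ⟨by norm_num⟩) _ _
    (by rw [ZMod.ringChar_zmod_n]; decide), ZMod.card]
  decide +kernel

end Summit.BirchSwinnertonDyer.BirchSwinnertonDyer.Rank1Residual.X11RankOne
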